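import Literature.AnabelianGeometry.SemiGraphs.ArithTotalEstrangementDoubleLoopBranchTransport
import HarnessLib

/-!
# [SemiAnbd] Def 5.3 (ii) at the SEGMENT `𝒟₁ = doubleLoop p`: the OPEN-KERNEL complement (no branch transport)

Mochizuki, *Semi-graphs of anabelioids*, Publ. RIMS **42** (2006), §5 Def. 5.3 (ii) p. 65 (clause (B): "`b' = b`
and `g ∉ Π^temp_{𝔊,b}`"), Thm. 5.4 p. 66. [cite: MochizukiSemiAnbd2006, Def 5.3 (ii), p. 65]

PROOF-ONLY companion (abc-iut cell, layer L3, T54 board, row «HEST@SEGMENT-CHARACTER» complement; seat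
abc-iut-f-177 gen 9) of `ArithTotalEstrangementDoubleLoopBranchTransport.lean` (p492697: under the frame's
`hBR` + `noSwitchBase`, `hest` fails at `𝒟₁` whenever the index-`∣ (p − 1)` subgroups of `Π_A` are open).  Here
the case that needs NO branch transport at all: if `Ker ρ'` is OPEN (the split model `ρ' = 1`, or any outer
action through a finite quotient of `Π_A`), `hest` fails at `𝒟₁` for every choice of representatives —
abc-iut-w4-d040's second-clause obstruction `not_isArithEstrangedEdge_of_lt_of_isOpen_ker` BY NAME, fed with the
translation `g = ι χ₀(1,1) ∈ Π^temp_{𝔊,v₀} ∖ Π^temp_{𝔊,b₀}` (`exists_mem_arithVertGp_not_mem_arithBrGp_doubleLoop`: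
Thm 3.7 (i)–(iii), malnormality of the torus, temp-slimness).  abc-iut-w6-d072's split obstruction
(`not_isTotallyArithEstranged_of_trivial`) needs TWO branches at one vertex and does not reach the segment.
No definition, no new named fact; a statement about OUR surrogate witness; nothing here bears on [IUTchIII]
Cor. 3.12; typed ≠ proved.
-/

noncomputable section

namespace Literature.AnabelianGeometry.SemiGraphs

open Literature.AnabelianGeometry.EtaleTheta CategoryTheory Topology

namespace IwahoriWitness

open ProfiniteSemiGraph

variable (p : ℕ) [Fact p.Prime] (c : TemperedPiChart (doubleLoop p)) {PA : Type*} [Group PA]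
  (ρ' : PA →* TopOut c.G)

/-- **A translation of `Π^temp_{𝔊,v₀}` outside `Π^temp_{𝔊,b₀}` at the segment**, for EVERY outer action and
every choice of representatives: `g = ι χ₀(1,1)` for a verticial `χ₀` presenting `Rc.Hv v₀ = χ₀(P)`,
`Rc.Hb b₀ = χ₀(T_0)` (Thm 3.7 (i)–(iii); malnormality of the torus; temp-slimness for `ι` injective).
[cite: MochizukiSemiAnbd2006, Def 5.3 (ii), p. 65] -/
theorem exists_mem_arithVertGp_not_mem_arithBrGp_doubleLoop (Rc : ChartRepresentatives c) :
    ∃ g : outerSemidirectProduct ρ',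
      g ∈ arithVertGp Rc (toOuterSemidirectProduct ρ') (⟨false⟩ : (doubleLoop p).graph.Vertex) ∧
        g ∉ arithBrGp Rc (toOuterSemidirectProduct ρ') (⟨false⟩ : (doubleLoop p).graph.Branch) := by
  haveI := c.isTopologicalGroup
  let v₀ : (doubleLoop p).graph.Vertex := ⟨false⟩
  let b₀ : (doubleLoop p).graph.Branch := ⟨false⟩
  have hb₀ : (doubleLoop p).graph.abuts b₀ = some v₀ := rfl
  have h37 := doubleLoop_thm37Hypotheses p
  have hCV : CompactInVerticialAt (doubleLoop p) := compactInVerticialAt_of_finiteGraph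
  have hHv := Rc.Hv_mem v₀
  obtain ⟨ψ, hψ, -⟩ := Rc.Hv_mem v₀
  obtain ⟨β₀, hβ₀, x₀, -, hH₀, hK₀⟩ := exists_branch_presentation_of_edgeLike_le_verticialAt hCV h37
    (doubleLoop_isGraph p) c (Rc.Hb_mem b₀) hHv (Rc.Hb_le b₀ v₀ hb₀) ψ hψ
  simp only [doubleLoop_branchSubgroup, coeff_torusBranch] at hK₀
  obtain ⟨χ₀, hχ₀, hχ₀eq⟩ := exists_isVerticialHom_conj c ψ hψ x₀
  have hH : Rc.Hv v₀ = χ₀.toMonoidHom.range := by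
    rw [hH₀]; exact SubgroupMulAut.range_map_conj_eq_of_forall ψ.toMonoidHom χ₀.toMonoidHom x₀ hχ₀eq
  have hK : Rc.Hb b₀ = ((Iw.bHom (0 : ℤ_[p])).toMonoidHom.range).map χ₀.toMonoidHom := by
    rw [hK₀]; exact SubgroupMulAut.map_map_conj_eq_of_forall ψ.toMonoidHom χ₀.toMonoidHom x₀ hχ₀eq _
  have hχinj : Function.Injective χ₀.toMonoidHom := (verticialInjective_holds _ h37 c v₀).2 χ₀ hχ₀
  have hιinj : Function.Injective (toOuterSemidirectProduct ρ') :=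
    toOuterSemidirectProduct_injective ρ'
      (center_eq_bot_of_isSlimGroup (temperedPiSlim_holds _ h37.toProp36Hypotheses c))
  refine ⟨toOuterSemidirectProduct ρ' (χ₀.toMonoidHom (⟨1, 0⟩ : Iw p)), ?_, ?_⟩
  · refine mem_arithVertGp_of_map_eq c ρ' Rc _ ?_
    rw [hH]
    exact SubgroupMulAut.map_conj_of_mem ⟨(⟨1, 0⟩ : Iw p), rfl⟩
  · rw [arithBrGp_of_abuts Rc _ hb₀]
    intro hmem
    have h2 := (Subgroup.mem_inf.mp hmem).2
    rw [hK, map_mem_commensurator_map_iff hιinj, map_mem_commensurator_map_iff hχinj] at h2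
    exact Iw.one_zero_not_mem_commensurator h2

/-- **Open-kernel complement at the segment** (no `hBR` needed): if `Ker ρ'` is OPEN in `Π_A` — e.g. the split
model `ρ' = 1`, or any outer action through a finite quotient — then Def. 5.3 (ii) fails at `𝒟₁ = doubleLoop p`
for every choice of representatives (abc-iut-w4-d040's `not_isArithEstrangedEdge_of_lt_of_isOpen_ker` at the
translation of `exists_mem_arithVertGp_not_mem_arithBrGp_doubleLoop`). [cite: MochizukiSemiAnbd2006, Def 5.3 (ii), p. 65] -/
theorem not_isTotallyArithEstranged_doubleLoop_of_isOpen_ker [TopologicalSpace PA] [ContinuousMul PA]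
    (hker : IsOpen (ρ'.ker : Set PA)) (Rc : ChartRepresentatives c) :
    ¬ IsTotallyArithEstranged (decompositionDataOfChart Rc (toOuterSemidirectProduct ρ'))
      (outerSemidirectProductSnd ρ') := by
  intro hest
  obtain ⟨g, hgv, hgb⟩ := exists_mem_arithVertGp_not_mem_arithBrGp_doubleLoop p c ρ' Rc
  exact not_isArithEstrangedEdge_of_lt_of_isOpen_ker c ρ' hker Rc (v := ⟨false⟩) (b := ⟨false⟩) rfl hgv hgb
    (hest _)

/-- **The split model at the segment**: for the TRIVIAL outer action (`E ≅ π₁^temp(𝒟₁) × Π_A`), Def. 5.3 (ii)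
fails at `𝒟₁` for every topological group `Π_A` and every choice of representatives.
[cite: MochizukiSemiAnbd2006, Def 5.3 (ii), p. 65] -/
theorem not_isTotallyArithEstranged_doubleLoop_trivial [TopologicalSpace PA] [ContinuousMul PA]
    (Rc : ChartRepresentatives c) :
    ¬ IsTotallyArithEstranged (decompositionDataOfChart Rc (toOuterSemidirectProduct (1 : PA →* TopOut c.G)))
      (outerSemidirectProductSnd (1 : PA →* TopOut c.G)) :=
  not_isTotallyArithEstranged_doubleLoop_of_isOpen_ker p c 1
    (by rw [MonoidHom.ker_one, Subgroup.coe_top]; exact isOpen_univ) Rc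

end IwahoriWitness

end Literature.AnabelianGeometry.SemiGraphs
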